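import Summits.NavierStokesRegularity.NavierStokesRegularity.Theorems.SqueezeCycleExtremalElementExists
import Summits.NavierStokesRegularity.NavierStokesRegularity.Theorems.SqueezeCycleExtremalBiaxialitySubcriticalGaugeStrainBound
import Literature.Analysis.FluidPDE.TypeIAncientMild
import Literature.Analysis.FluidPDE.LerayGaugeStrainSpectrum
import HarnessLib

/-!
# Route `SqueezeCycle`, crux `ExtremalBiaxialitySubcritical` — the class-wide stretching record
# is attained (line `oseen-shell-polar-tomography`, stub `stub_stretchRecordAttained`)

Helper file for item `stmt-NavierStokesRegularity-11609`
(`Summit.NavierStokesRegularity.NavierStokesRegularity.Theses.SqueezeCycle.ExtremalBiaxialitySubcritical`).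

Main result `stub_stretchRecordAttained`: if the Type-I model class `𝒦_C`
(`IsTypeIAncientMild C` plus the two scale-invariant local energy bounds) is inhabited, then the
supremum `M` of the Leray-gauge **stretching rate** `(−t)⟪∇v(t,x)e, e⟫` over `v ∈ 𝒦_C`, `t < 0`,
`x ∈ ℝ³` and unit directions `e` (i.e. of `(−t)λ₁(sym ∇v(t,x))`) is finite and **attained** by
some `(u₁, t₁, x₁, e₁)` with `u₁ ∈ 𝒦_C`, `t₁ = −1`, `x₁ = 0`, `‖e₁‖ = 1`. This is the `λ₁`-twin
of the proved route item `ExtremalElementExists` (`exists_extremal_lerayMiddleStrain`), and the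
proof is the same:

1. the class-uniform gauge gradient bound `(−t)‖∇v(t)(x)‖ ≤ K₀(C)`
   (`exists_gauge_norm_fderiv_le_of_typeI`, KNSS 2009 Prop. 4.1) bounds every value, since
   `⟪A e, e⟫ ≤ ‖A‖` for a unit vector `e`;
2. every clause of `𝒦_C` is invariant under the Navier–Stokes zoom about `(0, x)` with factor
   `c = √(−t)` (`isTypeIAncientMild_zoom`, `energyBounds_zoom`), and
   `∇(zoom v)(−1)(0) = (−t) ∇v(t)(x)` (`fderiv_zoom`), so every value at `(t, x, e)` is a value
   at `(−1, 0, e)`;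
3. a maximising sequence (`exists_seq_tendsto_sSup`), normalised to `(−1, 0)`, has a subsequence
   along which the unit directions converge (compactness of the unit sphere) and then a further
   subsequence converging with gradients to an element `W` of the class
   (`exists_tendsto_of_isTypeIAncientMild_seq`, `energyBounds_of_tendsto`); joint continuity of
   `(A, e) ↦ ⟪A e, e⟫` identifies the value of `W` at `(−1, 0, e_∞)` with `M`.

Source: G. Koch, N. Nadirashvili, G. Seregin, V. Šverák, *Liouville theorems for the
Navier–Stokes equations and applications*, Acta Math. 203 (2009), Prop. 4.1 and Lemma 6.1
(arXiv:0709.3599, pp. 8, 11) — the class-uniform derivative bounds and the compactness of the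
class of bounded ancient mild solutions.
-/

noncomputable section

open MeasureTheory Set Filter Topology Metric
open scoped RealInnerProductSpace

set_option linter.dupNamespace false

namespace Summit.NavierStokesRegularity.NavierStokesRegularity.Theorems

open Literature.Analysis Literature.Analysis.FluidPDE

/-- **The diagonal entries of a continuous linear map in unit directions are bounded by its
operator norm**: `⟪A e, e⟫ ≤ ‖A‖` for `‖e‖ = 1` (Cauchy–Schwarz and `‖A e‖ ≤ ‖A‖ ‖e‖`). [folklore] -/
theorem inner_apply_self_le_opNorm
    (A : EuclideanSpace ℝ (Fin 3) →L[ℝ] EuclideanSpace ℝ (Fin 3)) {e : EuclideanSpace ℝ (Fin 3)}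
    (he : ‖e‖ = 1) : ⟪A e, e⟫ ≤ ‖A‖ :=
  calc ⟪A e, e⟫ ≤ ‖A e‖ * ‖e‖ := real_inner_le_norm _ _
    _ ≤ ‖A‖ * ‖e‖ * ‖e‖ := mul_le_mul_of_nonneg_right (A.le_opNorm e) (norm_nonneg _)
    _ = ‖A‖ := by rw [he, mul_one, mul_one]

/-- **stub_stretchRecordAttained** (line `oseen-shell-polar-tomography` of crux
`ExtremalBiaxialitySubcritical`) — the class-wide Leray-gauge stretching record is attained: if
`𝒦_C` (`IsTypeIAncientMild C` plus the scaled-energy clause) has an element `u`, then there are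
`u₁ ∈ 𝒦_C`, `t₁ < 0` (namely `t₁ = −1`), `x₁` (namely `0`), a unit vector `e₁` and `M` with
`(−t₁)⟪∇u₁(t₁,x₁)e₁, e₁⟫ = M` and `(−t)⟪∇v(t,x)e, e⟫ ≤ M` for every `v ∈ 𝒦_C`, `t < 0`, `x` and
unit `e`. Proof: module docstring — class-uniform gauge gradient bound
(`exists_gauge_norm_fderiv_le_of_typeI`), zoom to `(−1, 0)` (`isTypeIAncientMild_zoom`,
`energyBounds_zoom`, `fderiv_zoom`), a maximising sequence (`exists_seq_tendsto_sSup`),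
compactness of the unit sphere (`isCompact_sphere`) and of the class
(`exists_tendsto_of_isTypeIAncientMild_seq`, `energyBounds_of_tendsto`).
[cite: KochNadirashviliSereginSverak2009, Prop. 4.1 and Lemma 6.1 (arXiv:0709.3599 pp. 8, 11)] -/
theorem stub_stretchRecordAttained :
    ∀ (C : ℝ) (u : ℝ → EuclideanSpace ℝ (Fin 3) → EuclideanSpace ℝ (Fin 3)), (IsTypeIAncientMild C u ∧ (∀ (x₀ : EuclideanSpace ℝ (Fin 3)) (t₀ r : ℝ), t₀ ≤ 0 → 0 < r → (∀ t, t₀ - r^2 < t → t < t₀ → r⁻¹ * ∫ x in Metric.ball x₀ r, ‖u t x‖^2 ≤ C) ∧ r⁻¹ * ∫ t in Set.Ioo (t₀ - r^2) t₀, ∫ x in Metric.ball x₀ r, ‖fderiv ℝ (u t) x‖^2 ≤ C)) → ∃ (u₁ : ℝ → EuclideanSpace ℝ (Fin 3) → EuclideanSpace ℝ (Fin 3)) (t₁ : ℝ) (x₁ e₁ : EuclideanSpace ℝ (Fin 3)) (M : ℝ), ((IsTypeIAncientMild C u₁ ∧ (∀ (x₀ : EuclideanSpace ℝ (Fin 3))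 (t₀ r : ℝ), t₀ ≤ 0 → 0 < r → (∀ t, t₀ - r^2 < t → t < t₀ → r⁻¹ * ∫ x in Metric.ball x₀ r, ‖u₁ t x‖^2 ≤ C) ∧ r⁻¹ * ∫ t in Set.Ioo (t₀ - r^2) t₀, ∫ x in Metric.ball x₀ r, ‖fderiv ℝ (u₁ t) x‖^2 ≤ C)) ∧ t₁ < 0 ∧ ‖e₁‖ = 1 ∧ (-t₁) * inner ℝ (fderiv ℝ (u₁ t₁) x₁ e₁) e₁ = M ∧ (∀ v : ℝ → EuclideanSpace ℝ (Fin 3) → EuclideanSpace ℝ (Fin 3), (IsTypeIAncientMild C v ∧ (∀ (x₀ : EuclideanSpace ℝ (Fin 3)) (t₀ r : ℝ), t₀ ≤ 0 → 0 < r → (∀ t, t₀ - r^2 < t → t < t₀ → r⁻¹ * ∫ x in Metric.ball x₀ r, ‖v t x‖^2 ≤ C) ∧ r⁻¹ * ∫ t in Set.Ioo (t₀ - r^2) t₀, ∫ x in Metric.ball x₀ r, ‖fderiv ℝ (v t) x‖^2 ≤ C)) → ∀ t < 0, ∀ (x e : EuclideanSpace ℝ (Fin 3)), ‖e‖ = 1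 → (-t) * inner ℝ (fderiv ℝ (v t) x e) e ≤ M)) := by
  rintro C u ⟨hu, hen⟩
  -- the energy clause as a predicate
  set En : (ℝ → EuclideanSpace ℝ (Fin 3) → EuclideanSpace ℝ (Fin 3)) → Prop := fun v =>
    ∀ (x₀ : EuclideanSpace ℝ (Fin 3)) (t₀ r : ℝ), t₀ ≤ 0 → 0 < r →
      (∀ t, t₀ - r ^ 2 < t → t < t₀ → r⁻¹ * ∫ x in ball x₀ r, ‖v t x‖ ^ 2 ≤ C) ∧
        r⁻¹ * ∫ t in Ioo (t₀ - r ^ 2) t₀, ∫ x in ball x₀ r, ‖fderiv ℝ (v t) x‖ ^ 2 ≤ C with hEn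
  change En u at hen
  -- ## the class-uniform bound of the gauge stretching rate
  obtain ⟨K₀, hK₀⟩ := exists_gauge_norm_fderiv_le_of_typeI C
  have hbound : ∀ v : ℝ → EuclideanSpace ℝ (Fin 3) → EuclideanSpace ℝ (Fin 3),
      IsTypeIAncientMild C v → ∀ t < 0, ∀ (x e : EuclideanSpace ℝ (Fin 3)), ‖e‖ = 1 →
        (-t) * ⟪fderiv ℝ (v t) x e, e⟫ ≤ K₀ := fun v hv t ht x e he =>
    (mul_le_mul_of_nonneg_left (inner_apply_self_le_opNorm (fderiv ℝ (v t) x) he)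
      (neg_pos.2 ht).le).trans (hK₀ hv t ht x)
  -- ## the normalisation to `(-1, 0)` by the zoom about `(0, x)` with factor `√(-t)`
  have hzoom : ∀ v : ℝ → EuclideanSpace ℝ (Fin 3) → EuclideanSpace ℝ (Fin 3),
      IsTypeIAncientMild C v → En v → ∀ t < 0, ∀ x : EuclideanSpace ℝ (Fin 3),
        ∃ v' : ℝ → EuclideanSpace ℝ (Fin 3) → EuclideanSpace ℝ (Fin 3),
          IsTypeIAncientMild C v' ∧ En v' ∧ ∀ e : EuclideanSpace ℝ (Fin 3),
            (-(-1 : ℝ)) * ⟪fderiv ℝ (v' (-1)) 0 e, e⟫ = (-t) * ⟪fderiv ℝ (v t) x e, e⟫ := by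
    intro v hv hve t ht x
    set c : ℝ := Real.sqrt (-t) with hcdef
    have hc : 0 < c := Real.sqrt_pos.2 (neg_pos.2 ht)
    have hc2 : c ^ 2 = -t := Real.sq_sqrt (neg_pos.2 ht).le
    refine ⟨c • stPull (c ^ 2) c 0 x v, isTypeIAncientMild_zoom hv hc x,
      energyBounds_zoom hv hve hc x, fun e => ?_⟩
    have hd : Differentiable ℝ (v (c ^ 2 * (-1))) := by
      rw [hc2, show -t * (-1) = t by ring]
      exact (hv.contDiff_slice ht).differentiable (by simp)
    rw [fderiv_zoom x v hd 0, smul_zero, add_zero, _root_.smul_apply,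
      real_inner_smul_left, hc2, show -t * (-1) = t by ring]
    ring
  -- ## the supremum
  set S : Set ℝ := {q | ∃ (v : ℝ → EuclideanSpace ℝ (Fin 3) → EuclideanSpace ℝ (Fin 3)) (t : ℝ)
    (x e : EuclideanSpace ℝ (Fin 3)), IsTypeIAncientMild C v ∧ En v ∧ t < 0 ∧ ‖e‖ = 1 ∧
      q = (-t) * ⟪fderiv ℝ (v t) x e, e⟫} with hS
  have hSbdd : BddAbove S :=
    ⟨K₀, by rintro q ⟨v, t, x, e, hv, -, ht, he, rfl⟩; exact hbound v hv t ht x e he⟩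
  have hmemS : ∀ v t x e, IsTypeIAncientMild C v → En v → t < 0 → ‖e‖ = 1 →
      (-t) * ⟪fderiv ℝ (v t) x e, e⟫ ∈ S :=
    fun v t x e hv hve ht he => ⟨v, t, x, e, hv, hve, ht, he, rfl⟩
  have he0 : ‖(EuclideanSpace.single 0 1 : EuclideanSpace ℝ (Fin 3))‖ = 1 := by
    rw [PiLp.norm_single, norm_one]
  have hSne : S.Nonempty :=
    ⟨_, hmemS u (-1) 0 (EuclideanSpace.single 0 1) hu hen (by norm_num) he0⟩
  set M : ℝ := sSup S with hM
  have hle : ∀ v t x e, IsTypeIAncientMild C v → En v → t < 0 → ‖e‖ = 1 →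
      (-t) * ⟪fderiv ℝ (v t) x e, e⟫ ≤ M :=
    fun v t x e hv hve ht he => le_csSup hSbdd (hmemS v t x e hv hve ht he)
  -- ## a maximising sequence, normalised to `(-1, 0)`
  obtain ⟨qs, -, hqlim, hqmem⟩ := exists_seq_tendsto_sSup hSne hSbdd
  have hseq : ∀ k, ∃ (w : ℝ → EuclideanSpace ℝ (Fin 3) → EuclideanSpace ℝ (Fin 3))
      (e : EuclideanSpace ℝ (Fin 3)), IsTypeIAncientMild C w ∧ En w ∧ ‖e‖ = 1 ∧
        (-(-1 : ℝ)) * ⟪fderiv ℝ (w (-1)) 0 e, e⟫ = qs k := by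
    intro k
    obtain ⟨v, t, x, e, hv, hve, ht, he, hq⟩ := hqmem k
    obtain ⟨v', hv', hve', heq⟩ := hzoom v hv hve t ht x
    exact ⟨v', e, hv', hve', he, by rw [heq e, hq]⟩
  choose w e hwc hwe hwe1 hwq using hseq
  -- ## compactness of the unit sphere: a convergent subsequence of directions
  obtain ⟨eL, heL, ψ, hψ, hψlim⟩ :=
    (isCompact_sphere (0 : EuclideanSpace ℝ (Fin 3)) 1).tendsto_subseq (x := e)
      fun k => mem_sphere_zero_iff_norm.2 (hwe1 k)
  rw [mem_sphere_zero_iff_norm] at heL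
  -- ## compactness of the class along the subsequence
  obtain ⟨φ, hφ, W, hWc, hpt, hptG, -, -⟩ :=
    exists_tendsto_of_isTypeIAncientMild_seq C (w := fun k => w (ψ k)) fun k => hwc (ψ k)
  have hWe : En W :=
    energyBounds_of_tendsto C (w := fun j => w (ψ (φ j))) (fun j => hwc (ψ (φ j)))
      (fun j => hwe (ψ (φ j))) hWc hpt hptG
  -- ## the supremum is attained at `(-1, 0, eL)` by `W`
  have hval : (-(-1 : ℝ)) * ⟪fderiv ℝ (W (-1)) 0 eL, eL⟫ = M := by
    have h1 : Tendsto (fun j => (-(-1 : ℝ)) *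
        ⟪fderiv ℝ (w (ψ (φ j)) (-1)) 0 (e (ψ (φ j))), e (ψ (φ j))⟫) atTop (𝓝 M) :=
      (hqlim.comp (hψ.comp hφ).tendsto_atTop).congr fun j => (hwq (ψ (φ j))).symm
    have he' : Tendsto (fun j => e (ψ (φ j))) atTop (𝓝 eL) := hψlim.comp hφ.tendsto_atTop
    have hG : Tendsto (fun j => fderiv ℝ (w (ψ (φ j)) (-1)) 0) atTop
        (𝓝 (fderiv ℝ (W (-1)) 0)) := hptG (-1) (by norm_num) 0
    have happ : Continuous fun p : (EuclideanSpace ℝ (Fin 3) →L[ℝ] EuclideanSpace ℝ (Fin 3)) ×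
        EuclideanSpace ℝ (Fin 3) => p.1 p.2 := continuous_fst.clm_apply continuous_snd
    have hGe : Tendsto (fun j => fderiv ℝ (w (ψ (φ j)) (-1)) 0 (e (ψ (φ j)))) atTop
        (𝓝 (fderiv ℝ (W (-1)) 0 eL)) := (happ.tendsto _).comp (hG.prodMk_nhds he')
    have h2 : Tendsto (fun j => (-(-1 : ℝ)) *
        ⟪fderiv ℝ (w (ψ (φ j)) (-1)) 0 (e (ψ (φ j))), e (ψ (φ j))⟫) atTop
        (𝓝 ((-(-1 : ℝ)) * ⟪fderiv ℝ (W (-1)) 0 eL, eL⟫)) := (hGe.inner he').const_mul _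
    exact tendsto_nhds_unique h2 h1
  exact ⟨W, -1, 0, eL, M, ⟨hWc, hWe⟩, by norm_num, heL, hval,
    fun v hv t ht x e he => hle v t x e hv.1 hv.2 ht he⟩

end Summit.NavierStokesRegularity.NavierStokesRegularity.Theorems

end
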